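import Summits.QuantumFields.YangMills.Theorems.UnitScaleTiltFluctuationComparisonRegPrTwoRunBlockGeometry
import Summits.QuantumFields.YangMills.Theorems.AlphaInputsT3ACv3Pint
import HarnessLib

/-!
# Crux `FluctuationComparisonRegPrL` (stmt-QuantumFields-19935), v5j′ STUB 3″′ `stub_pintDecompTwoRunMinFam`: THE BLOCK DECOMPOSITION — (B)∧(C) over the
# coarse-field-indexed term sockets FROM ONE GLOBAL TWO-RUN CAUCHY ROW + the trivial-history `PintSize` + block geometry (NOTE N-g4-2 of this seat, kernel form)
# (support file `--supports stmt-QuantumFields-19935`)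

Fleet seat `ym-ust-19201-p2` (gen 4, v5j pen).  WHAT THIS FILE PROVES (block geometry = part 1 `…TwoRunBlockGeometry.lean`).  §2 the EVEN-SPLIT term function over blocks: for a family
`p` of v3 packages, `πblk F` (localisation domains := the blocks of the term's own level at the trivial history, the whole torus at the junk levels `j > K`, tree
length `0`) and `PTblk p` (`Pint/#blocks` on each block); `PintDecompTrivT (dataOfV3 p (πblk F)) (PTblk p)` IDENTICALLY; `LocCover` (constant `1`), `LocBlockVolume`,
`LocMatched`.  §3 **`twoRunMinT_blocks_of_global`**: `TermSizeTrivT` ⟸ the family's own (46) at the trivial history (`PkgAtV3.abs_Pint_succ_le`, no hypothesis), `PolymerCauchyMinAtT` ⟸ ONE GLOBAL ROW per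
`(K, n < K)` — `|Pint^{(K+1)}_{K+1−n}(triv, fs′V) − Pint^{(K)}_{K−n}(triv, fs V) − c K n| ≤ C·θ(n)²·sitesPerDir_K(K−n)³·(L^{−(K−n)})^a` on the θ(n)-window (`hG`) — hence
`∃ π PT, PintDecompTrivT ∧ TwoRunMinT` for the family datum.  CONSEQUENCE (N-g4-2): the polymer localisation of STUB 3″′ is not load-bearing; its content is the global
two-run Cauchy estimate for a COHERENT admissible family ([King1986] Thm 3.4 in global form; unprinted for non-abelian d = 3).  Nothing of Bałaban's or King's is asserted.

References: T. Bałaban, CMP 109 (1987) 249–301 [Balaban1987RG1] ((0.1)–(0.3) pp.251–252); CMP 102 (1985) 255–275 [Balaban1985UV3] ((43)–(46) pp.266–267); C. King, CMP 102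
(1986) 649–677 [King1986] (Thm 3.4 (3.9) p.656).
-/

set_option autoImplicit false

noncomputable section

namespace Summit.QuantumFields.YangMills.Theorems.LogComparisonTwoRunBlocks

open MeasureTheory Filter
open Literature.MathematicalPhysics.QuantumFieldTheory.Balaban1983to89
open Literature.MathematicalPhysics.QuantumFieldTheory.Balaban1983to89.T3ContinuumYM3Torus
open Literature.MathematicalPhysics.QuantumFieldTheory.Balaban1983to89.T3UnitScaleTilt (θBal)
open Literature.MathematicalPhysics.QuantumFieldTheory.Balaban1983to89.T3LevelShift (fieldShift siteShift siteShift_blockOf siteShift_siteShift siteShift_refl)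
open Literature.MathematicalPhysics.QuantumFieldTheory.Balaban1983to89.T3AlphaInputsAC
open Literature.MathematicalPhysics.QuantumFieldTheory.Balaban1983to89.T3AlphaPolymerSocket
open Literature.MathematicalPhysics.QuantumFieldTheory.Balaban1983to89.T3AlphaInputsACTwoRunLevel
open Literature.MathematicalPhysics.QuantumFieldTheory.Balaban1985CMP102
open Literature.MathematicalPhysics.QuantumFieldTheory.Balaban1985CMP102.Setting
open Summit.QuantumFields.Balaban3D.Carriers
open Summit.QuantumFields.Balaban3D.Proofs.Primitives
open Summit.QuantumFields.Balaban3D.Proofs.StandardAC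
open Summit.QuantumFields.Balaban3D.Proofs.InputsAC

/-! ## §2 The even-split decomposition over blocks: polymer parameter, term function, (43), and the geometric clauses -/

section Blocks

variable {F : T3Family} {𝔠 : AlphaConsts F.L (suGroupModel 2).N} {γ : ℝ} {hγ : 0 < γ} {hγ1 : γ ≤ (min 𝔠.gamma0 1) ^ 2}

open Classical in
/-- **THE BLOCK POLYMER PARAMETER**: at the trivial history of a lattice level `j ≤ K` the localisation domains of term level `i = j` are the scale-`j` blocks (none at
`i ≠ j`); at the junk levels `j > K` (never read by a consumer) the whole torus at term level `1`; no domains at non-trivial histories; tree lengths `0`; `Pterm`/`enl`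
inert (the coarse-field-indexed sockets never read them). [cite: Balaban1985UV3, (43) p.266] -/
def πblk (F : T3Family) : AlphaInputsT3AC.PolymerT3 F where
  Loc := fun K j h i =>
    if h = Hist.triv (F.P K) j then
      (if j ≤ K then (if i = j then blocks F K j else ∅) else (if i = 1 then {Set.univ} else ∅))
    else ∅
  Pterm := fun _ _ _ _ => 0
  enl := fun _ _ Y => Y
  treeLen := fun _ _ _ => 0

/-- **THE EVEN-SPLIT TERM FUNCTION OF A FAMILY OF v3 PACKAGES**: at a lattice level `j ≤ K`, term level `i = j`, every block carries `Pint_j(triv, W)/#blocks`; at the junk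
levels the single domain carries `Pint_j(triv, W)`; `0` elsewhere. [cite: Balaban1985UV3, (43) p.266] -/
def PTblk (p : ∀ K, AlphaInputsT3AC.PkgAtV3 F 𝔠 γ hγ hγ1 K) : TermFn F := fun K j i _ W =>
  if j ≤ K then (if i = j then (p K).T.Pint j (Hist.triv (F.P K) j) W / (((F.P K).sitesPerDir j ^ 3 : ℕ) : ℝ) else 0)
  else (if i = 1 then (p K).T.Pint j (Hist.triv (F.P K) j) W else 0)

variable (p : ∀ K, AlphaInputsT3AC.PkgAtV3 F 𝔠 γ hγ hγ1 K)

/-- `πblk`'s domains at the trivial history (definitional unfolding). [folklore] -/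
theorem πblk_loc_triv (K j i : ℕ) :
    (πblk F).Loc K j (Hist.triv (F.P K) j) i = (if j ≤ K then (if i = j then blocks F K j else ∅) else (if i = 1 then {Set.univ} else ∅)) := by
  unfold πblk
  exact if_pos rfl

/-- `πblk` lists no domain at a non-trivial history. [folklore] -/
theorem πblk_loc_of_ne (K j i : ℕ) {h : Hist (F.P K) j} (hne : h ≠ Hist.triv (F.P K) j) : (πblk F).Loc K j h i = ∅ := by
  unfold πblk
  exact if_neg hne

/-- The datum's localisation domains at the trivial history ARE `πblk`'s (definitional unfolding). [folklore] -/
theorem loc_triv_eq (K j i : ℕ) :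
    (AlphaInputsT3AC.dataOfV3 p (πblk F)).Loc K j ((AlphaInputsT3AC.dataOfV3 p (πblk F)).triv K j) i =
      (if j ≤ K then (if i = j then blocks F K j else ∅) else (if i = 1 then {Set.univ} else ∅)) :=
  πblk_loc_triv (F := F) K j i

/-- The number of scale-`j` blocks as a real is positive. [folklore] -/
theorem nblocks_pos (K j : ℕ) : (0 : ℝ) < (((F.P K).sitesPerDir j ^ 3 : ℕ) : ℝ) := by
  have := (F.P K).sitesPerDir_ne_zero j
  positivity

/-- **(43) AT THE TRIVIAL HISTORY HOLDS IDENTICALLY FOR THE EVEN SPLIT**: `PintDecompTrivT (dataOfV3 p πblk) (PTblk p)`. [cite: Balaban1985UV3, (43) p.266] -/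
theorem pintDecompTrivT_blocks : PintDecompTrivT (AlphaInputsT3AC.dataOfV3 p (πblk F)) (PTblk p) := by
  intro K j W
  have hL : ∀ i, (AlphaInputsT3AC.dataOfV3 p (πblk F)).Loc K j ((AlphaInputsT3AC.dataOfV3 p (πblk F)).triv K j) i =
      (if j ≤ K then (if i = j then blocks F K j else ∅) else (if i = 1 then {Set.univ} else ∅)) := loc_triv_eq p K j
  rw [Finset.sum_congr rfl fun i _ => by rw [hL i]]
  show (p K).T.Pint j (Hist.triv (F.P K) j) W = _
  by_cases hjK : j ≤ K
  · simp only [if_pos hjK, PTblk]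
    rcases Nat.eq_zero_or_pos j with rfl | hj
    · -- level `0`: no interaction terms, empty index range
      rw [show Finset.Icc 1 0 = ∅ by decide, Finset.sum_empty]
      rfl
    · rw [Finset.sum_eq_single j]
      · rw [if_pos rfl, Finset.sum_const, card_blocks F K (by omega), if_pos rfl, nsmul_eq_mul]
        have hN := nblocks_pos (F := F) K j
        rw [mul_div_assoc']
        rw [eq_div_iff hN.ne']
        push_cast
        ring
      · intro i _ hij
        rw [if_neg hij, Finset.sum_empty]
      · intro hj'
        exact absurd (Finset.mem_Icc.mpr ⟨hj, le_rfl⟩) hj'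
  · simp only [if_neg hjK, PTblk]
    have hj1 : 1 ≤ j := by omega
    rw [Finset.sum_eq_single 1]
    · rw [if_pos rfl, Finset.sum_singleton, if_pos rfl]
    · intro i _ hi1
      rw [if_neg hi1, Finset.sum_empty]
    · intro h1
      exact absurd (Finset.mem_Icc.mpr ⟨le_rfl, hj1⟩) h1

/-- **`LocCover` with constant `1` at decay rate `1`** (tree lengths are `0`; every fine site lies in exactly one block). [cite: Balaban1985UV3, (45) p.267] -/
theorem locCover_blocks : LocCover (AlphaInputsT3AC.dataOfV3 p (πblk F)) 1 1 := by
  classical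
  refine ⟨fun _ _ _ => le_rfl, fun K j hh i y => ?_⟩
  have htl : ∀ Y, (AlphaInputsT3AC.dataOfV3 p (πblk F)).treeLen K i Y = 0 := fun _ => rfl
  simp_rw [htl, mul_zero, Real.exp_zero]
  show ∑ Y ∈ (πblk F).Loc K j hh i, Y.indicator (fun _ => (1 : ℝ)) y ≤ 1
  by_cases htriv : hh = Hist.triv (F.P K) j
  · rw [htriv, πblk_loc_triv]
    by_cases hjK : j ≤ K
    · rw [if_pos hjK]
      by_cases hij : i = j
      · rw [if_pos hij, sum_blocks_indicator F K (by omega) y]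
      · rw [if_neg hij, Finset.sum_empty]; exact zero_le_one
    · rw [if_neg hjK]
      by_cases hi1 : i = 1
      · rw [if_pos hi1, Finset.sum_singleton, Set.indicator_of_mem (Set.mem_univ y)]
      · rw [if_neg hi1, Finset.sum_empty]; exact zero_le_one
  · rw [πblk_loc_of_ne (F := F) K j i htriv, Finset.sum_empty]
    exact zero_le_one

/-- The whole fine torus has at least `L³` sites: `L^{3} ≤ (2L^{m+K})³`. [folklore] -/
theorem pow_three_le_card_univ (K : ℕ) :
    (F.L : ℝ) ^ (3 * 1) ≤ ∑ y : Site (F.P K) 0, (Set.univ : Set (Site (F.P K) 0)).indicator (fun _ => (1 : ℝ)) y := by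
  simp only [Set.indicator_univ, Finset.sum_const, Finset.card_univ, nsmul_eq_mul, mul_one, Site.card_site, d_eq]
  have hL1 : (1 : ℝ) ≤ F.L := by exact_mod_cast F.hL.2.le
  have hsp : ((F.P K).sitesPerDir 0 : ℝ) = 2 * (F.L : ℝ) ^ (F.m + K) := by
    rw [show (F.P K).sitesPerDir 0 = 2 * F.L ^ (F.m + K - 0) from rfl, Nat.sub_zero]; push_cast; ring
  push_cast
  rw [hsp]
  have h0 : (0 : ℝ) ≤ (F.L : ℝ) ^ (F.m + K) := by positivity
  have h1 : (F.L : ℝ) ≤ 2 * (F.L : ℝ) ^ (F.m + K) := by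
    have h2 : (F.L : ℝ) ^ 1 ≤ (F.L : ℝ) ^ (F.m + K) := pow_le_pow_right₀ hL1 (by have := F.hm; omega)
    rw [pow_one] at h2
    linarith
  calc (F.L : ℝ) ^ (3 * 1) = (F.L : ℝ) ^ 3 := by norm_num
    _ ≤ (2 * (F.L : ℝ) ^ (F.m + K)) ^ 3 := pow_le_pow_left₀ (by positivity) h1 3

/-- **`LocBlockVolume`**: every listed domain has at least `L^{3i}` fine sites (a scale-`i` block has exactly `L^{3i}`; the junk-level torus has `(2L^{m+K})³ ≥ L³`).
[cite: Balaban1985UV3, (24) p.262] -/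
theorem locBlockVolume_blocks : LocBlockVolume (AlphaInputsT3AC.dataOfV3 p (πblk F)) := by
  classical
  intro K j hh i Y hY
  change Y ∈ (πblk F).Loc K j hh i at hY
  by_cases htriv : hh = Hist.triv (F.P K) j
  · rw [htriv, πblk_loc_triv] at hY
    by_cases hjK : j ≤ K
    · rw [if_pos hjK] at hY
      by_cases hij : i = j
      · rw [if_pos hij] at hY
        obtain ⟨y, -, rfl⟩ := Finset.mem_image.mp hY
        rw [sum_indicator_blk, card_blkFin F K j (by omega) y, hij]
        push_cast
        exact le_rfl
      · rw [if_neg hij] at hY; exact absurd hY (Finset.notMem_empty _)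
    · rw [if_neg hjK] at hY
      by_cases hi1 : i = 1
      · rw [if_pos hi1, Finset.mem_singleton] at hY
        rw [hY, hi1]
        exact pow_three_le_card_univ (F := F) K
      · rw [if_neg hi1] at hY; exact absurd hY (Finset.notMem_empty _)
  · rw [πblk_loc_of_ne (F := F) K j i htriv] at hY
    exact absurd hY (Finset.notMem_empty _)

/-- **`LocMatched`**: at the comparison levels refinement maps run `K`'s scale-`(K−n)` blocks bijectively onto run `K+1`'s scale-`(K+1−n)` blocks; the other term levels
are empty on both sides. [cite: Balaban1985UV3, (24) p.262] -/
theorem locMatched_blocks : LocMatched (AlphaInputsT3AC.dataOfV3 p (πblk F)) := by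
  classical
  intro K n hn i hi1 hiK
  rw [loc_triv_eq, loc_triv_eq, if_pos (by omega : K - n ≤ K), if_pos (by omega : K + 1 - n ≤ K + 1)]
  by_cases hi : i = K - n
  · rw [if_pos hi, if_pos (by omega : i + 1 = K + 1 - n)]
    have hb := bijOn_refineSet_blocks F K (i := i) (by omega)
    rw [show i + 1 = K + 1 - n by omega] at hb
    rw [← hi]
    exact hb
  · rw [if_neg hi, if_neg (by omega : ¬ i + 1 = K + 1 - n), Finset.coe_empty, Finset.coe_empty]
    exact Set.bijOn_empty _

end Blocks

/-! ## §3 (C) from the trivial-history `PintSize` row of the family and ONE global two-run Cauchy row -/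

section Global

variable {F : T3Family} {𝔠 : AlphaConsts F.L (suGroupModel 2).N} {γ : ℝ} {hγ : 0 < γ} {hγ1 : γ ≤ (min 𝔠.gamma0 1) ^ 2}
  (p : ∀ K, AlphaInputsT3AC.PkgAtV3 F 𝔠 γ hγ hγ1 K)

/-- `PTblk` on a lattice level at its own term level (definitional unfolding). [folklore] -/
theorem PTblk_apply_eq {K j i : ℕ} (hjK : j ≤ K) (hij : i = j) (Y : Set (Site (F.P K) 0))
    (W : GaugeField (F.P K) j (Matrix.specialUnitaryGroup (Fin 2) ℂ)) :
    PTblk p K j i Y W = (p K).T.Pint j (Hist.triv (F.P K) j) W / (((F.P K).sitesPerDir j ^ 3 : ℕ) : ℝ) := by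
  unfold PTblk
  rw [if_pos hjK, if_pos hij]

/-- **(46) AT THE TRIVIAL HISTORY WITH THE FULL VOLUME**: `|Pint_j(triv, W)| ≤ (C46·M₁³)·θ(K−j+1)²·sitesPerDir(j)³`, `1 ≤ j ≤ K`, every `W`
(`PkgAtV3.abs_Pint_succ_le` + `|Λ| ≤ #T^{(j)}`). [cite: Balaban1985UV3, (46) p.267] -/
theorem abs_Pint_triv_le (K j : ℕ) (hj1 : 1 ≤ j) (hjK : j ≤ K) (W : GaugeField (F.P K) j (Matrix.specialUnitaryGroup (Fin 2) ℂ)) :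
    |(p K).T.Pint j (Hist.triv (F.P K) j) W| ≤
      (𝔠.C46 * (𝔠.M₁ : ℝ) ^ 3) * θBal F.L γ 𝔠.b₀ 𝔠.p₀ (K - j + 1) ^ 2 * (((F.P K).sitesPerDir j ^ 3 : ℕ) : ℝ) := by
  obtain ⟨k, rfl⟩ : ∃ k, j = k + 1 := ⟨j - 1, by omega⟩
  have h46 := (p K).abs_Pint_succ_le k hjK (Hist.triv (F.P K) (k + 1)) W
  have hvol := card_lamFin_le_sitesPerDir_cube (F := F) (K := K) 𝔠.lane.carrier.M₁
    (rcolOf (T3Scales F γ hγ (hγ1.trans (sq_min_one_le _ 𝔠.gamma0_pos)) K) 𝔠.lane.carrier) k (Hist.triv (F.P K) (k + 1))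
  have hC : 0 ≤ 𝔠.C46 * (𝔠.M₁ : ℝ) ^ 3 * θBal F.L γ 𝔠.b₀ 𝔠.p₀ (K - k) ^ 2 :=
    mul_nonneg (mul_nonneg 𝔠.C46_nonneg (pow_nonneg (Nat.cast_nonneg _) _)) (sq_nonneg _)
  have hKk : K - (k + 1) + 1 = K - k := by omega
  rw [hKk]
  refine h46.trans ((mul_le_mul_of_nonneg_left hvol hC).trans (le_of_eq ?_))
  push_cast
  ring

/-- **`TermSizeTrivT` FOR THE EVEN SPLIT, FROM THE FAMILY'S OWN (46)**: per block `|Pint/#blocks| ≤ (C46·M₁³)·θ(n+1)²` — `PkgAtV3.abs_Pint_succ_le` with the volume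
`|Λ| ≤ #T^{(K−n)} = #blocks`; no window is needed. [cite: Balaban1985UV3, (44)–(46) p.267] -/
theorem termSizeTrivT_blocks : TermSizeTrivT (AlphaInputsT3AC.dataOfV3 p (πblk F)) (PTblk p) 𝔠.b₀ 𝔠.p₀ (𝔠.C46 * (𝔠.M₁ : ℝ) ^ 3) 1 := by
  classical
  refine ⟨one_pos, fun K n hn V _ i hi1 hiK Y hY => ?_⟩
  rw [loc_triv_eq, if_pos (by omega : K - n ≤ K)] at hY
  by_cases hi : i = K - n
  · have htl : (AlphaInputsT3AC.dataOfV3 p (πblk F)).treeLen K i Y = 0 := rfl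
    rw [htl, mul_zero, Real.exp_zero, mul_one, show K - n - i = 0 by omega, pow_zero, inv_one, one_pow, mul_one]
    rw [PTblk_apply_eq p (by omega : K - n ≤ K) hi]
    have hN := nblocks_pos (F := F) K (K - n)
    rw [abs_div, abs_of_pos hN, div_le_iff₀ hN]
    have h := abs_Pint_triv_le p K (K - n) (by omega) (by omega)
      (fieldShift (F.sitesPerDir_eq (m := F.m) (K := K) (j := K - n) (m' := F.m) (K' := n) (j' := 0) (by omega)) V)
    rw [show K - (K - n) + 1 = n + 1 by omega] at h
    exact h
  · rw [if_neg hi] at hY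
    exact absurd hY (Finset.notMem_empty _)

/-- **`PolymerCauchyMinAtT` FOR THE EVEN SPLIT ⟸ ONE GLOBAL TWO-RUN ROW**: if for every `K` and `n < K` there is a constant `c K n` with
`|Pint^{(K+1)}_{K+1−n}(triv, fs′V) − Pint^{(K)}_{K−n}(triv, fs V) − c K n| ≤ C·θ(n)²·sitesPerDir_K(K−n)³·(L^{−(K−n)})^a` on the θ(n)-window, then the per-block comparison holds with
shifts `c K n / #blocks` (the two runs have the same number of blocks at the common scale). [cite: King1986, Thm 3.4 (3.9) p.656] -/
theorem polymerCauchyMinAtT_blocks_of_global {a C : ℝ}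
    (hG : ∃ c : ℕ → ℕ → ℝ, ∀ (K n : ℕ) (hnK : n < K) (V : GaugeField (F.P n) 0 (Matrix.specialUnitaryGroup (Fin 2) ℂ)),
      PlaqSmall (θBal F.L γ 𝔠.b₀ 𝔠.p₀ n) V →
        |(p (K + 1)).T.Pint (K + 1 - n) (Hist.triv (F.P (K + 1)) (K + 1 - n))
            (fieldShift (F.sitesPerDir_eq (m := F.m) (K := K + 1) (j := K + 1 - n) (m' := F.m) (K' := n) (j' := 0) (by omega)) V) -
          (p K).T.Pint (K - n) (Hist.triv (F.P K) (K - n))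
            (fieldShift (F.sitesPerDir_eq (m := F.m) (K := K) (j := K - n) (m' := F.m) (K' := n) (j' := 0) (by omega)) V) - c K n| ≤
          C * θBal F.L γ 𝔠.b₀ 𝔠.p₀ n ^ 2 * (((F.P K).sitesPerDir (K - n) ^ 3 : ℕ) : ℝ) * (((F.L : ℝ) ^ (K - n))⁻¹) ^ a) :
    PolymerCauchyMinAtT (AlphaInputsT3AC.dataOfV3 p (πblk F)) (PTblk p) 𝔠.b₀ 𝔠.p₀ 1 a C := by
  classical
  obtain ⟨c, hc⟩ := hG
  refine ⟨fun K n _ _ => c K n / (((F.P K).sitesPerDir (K - n) ^ 3 : ℕ) : ℝ), fun K n hn j hj V hV Y hY => ?_⟩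
  rw [loc_triv_eq, if_pos (by omega : K - n ≤ K)] at hY
  by_cases hj1 : 1 + j = K - n
  · rw [if_pos hj1] at hY
    have hnK : n < K := by omega
    have htl : (AlphaInputsT3AC.dataOfV3 p (πblk F)).treeLen K (1 + j) Y = 0 := rfl
    rw [htl, mul_zero, Real.exp_zero, mul_one, show K - n - 1 - j = 0 by omega, pow_zero, inv_one, one_pow, mul_one]
    -- both runs have the same number of blocks at the common physical scale
    have hNN : (F.P (K + 1)).sitesPerDir (K + 1 - n) = (F.P K).sitesPerDir (K - n) := by
      have := sitesPerDir_succ_eq F K (K - n)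
      rw [show K - n + 1 = K + 1 - n by omega] at this
      exact this.symm
    rw [PTblk_apply_eq p (by omega : K + 1 - n ≤ K + 1) (by omega : 1 + (j + 1) = K + 1 - n),
      PTblk_apply_eq p (by omega : K - n ≤ K) hj1]
    rw [hNN, hj1]
    have hN := nblocks_pos (F := F) K (K - n)
    have key := hc K n hnK V hV
    rw [← sub_div, ← sub_div, abs_div, abs_of_pos hN, div_le_iff₀ hN]
    refine key.trans (le_of_eq ?_)
    ring
  · rw [if_neg hj1] at hY
    exact absurd hY (Finset.notMem_empty _)

/-- **THE BLOCK ADAPTER** (N-g4-2 in the kernel): for EVERY family of v3 packages, ONE global two-run Cauchy row for its trivial-history interaction sums gives a polymer parameter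
and a term function with `PintDecompTrivT ∧ TwoRunMinT` — the conclusion of v5j′'s STUB 3″′ for that family (decay rate `κ₁ = 1`, term-size constant `C46·M₁³`, cover constant `1`).
[cite: Balaban1985UV3, (43)–(46) pp.266–267; King1986, Thm 3.4 (3.9) p.656] -/
theorem twoRunMinT_blocks_of_global {a C : ℝ}
    (hG : ∃ c : ℕ → ℕ → ℝ, ∀ (K n : ℕ) (hnK : n < K) (V : GaugeField (F.P n) 0 (Matrix.specialUnitaryGroup (Fin 2) ℂ)),
      PlaqSmall (θBal F.L γ 𝔠.b₀ 𝔠.p₀ n) V →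
        |(p (K + 1)).T.Pint (K + 1 - n) (Hist.triv (F.P (K + 1)) (K + 1 - n))
            (fieldShift (F.sitesPerDir_eq (m := F.m) (K := K + 1) (j := K + 1 - n) (m' := F.m) (K' := n) (j' := 0) (by omega)) V) -
          (p K).T.Pint (K - n) (Hist.triv (F.P K) (K - n))
            (fieldShift (F.sitesPerDir_eq (m := F.m) (K := K) (j := K - n) (m' := F.m) (K' := n) (j' := 0) (by omega)) V) - c K n| ≤
          C * θBal F.L γ 𝔠.b₀ 𝔠.p₀ n ^ 2 * (((F.P K).sitesPerDir (K - n) ^ 3 : ℕ) : ℝ) * (((F.L : ℝ) ^ (K - n))⁻¹) ^ a) :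
    ∃ (π : AlphaInputsT3AC.PolymerT3 F) (PT : TermFn F),
      PintDecompTrivT (AlphaInputsT3AC.dataOfV3 p π) PT ∧ TwoRunMinT (AlphaInputsT3AC.dataOfV3 p π) PT 𝔠.b₀ 𝔠.p₀ a :=
  ⟨πblk F, PTblk p, pintDecompTrivT_blocks p,
    1, ⟨_, termSizeTrivT_blocks p⟩, ⟨1, locCover_blocks p⟩, locBlockVolume_blocks p, locMatched_blocks p,
    ⟨C, polymerCauchyMinAtT_blocks_of_global p hG⟩⟩

end Global

/-! ## §4 v5j′ STUB 3″′ FROM A GLOBAL-ROW FAMILY STATEMENT (registered quantifier shape) -/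

section Registered

/-- **v5j′ STUB 3″′ `stub_pintDecompTwoRunMinFam` ⟸ «every large profile's record admits, below a coupling threshold, a COHERENT admissible family of v3 packages with ONE
global two-run Cauchy row»** — the registered text of 3″′ VERBATIM as conclusion; the block adapter `twoRunMinT_blocks_of_global` supplies `π`, `PT` and the five clauses.
So the crux-plan / lane target for 3″′ is the polymer-free hypothesis `hGlob` (NOTE N-g4-2). [cite: King1986, Thm 3.4 (3.9) p.656; Balaban1985UV3, (43)–(46) pp.266–267] -/
theorem stub_pintDecompTwoRunMinFam_of_global
    (hGlob : ∀ (L : ℕ), Odd L → 7 ≤ L →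
      ∀ (𝔠 : Summit.QuantumFields.Balaban3D.Proofs.Primitives.AlphaConsts L (Summit.QuantumFields.Balaban3D.Carriers.suGroupModel 2).N) (a₀ a₁ : ℝ),
        0 < a₀ → 0 < a₁ → 𝔠.B₃ * a₁ ≤ a₀ →
        ∃ a : ℝ, 0 < a ∧ ∃ C : ℝ, ∃ γB : ℝ, 0 < γB ∧ ∀ (F : T3Family) (γ : ℝ) (hF : F.L = L) (hγ : 0 < γ), γ ≤ γB →
          ∀ (hγ1 : γ ≤ (min (hF ▸ 𝔠).gamma0 1) ^ 2),
            Summit.QuantumFields.YangMills.Theorems.AlphaInputsT3AC.OfV3At F (hF ▸ 𝔠) a₀ a₁ →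
            ∃ (p : ∀ K, Summit.QuantumFields.YangMills.Theorems.AlphaInputsT3AC.PkgAtV3 F (hF ▸ 𝔠) γ hγ hγ1 K),
              (∀ K, (p K).a₀ = a₀ ∧ (p K).a₁ = a₁) ∧
              ∃ c : ℕ → ℕ → ℝ, ∀ (K n : ℕ) (hnK : n < K) (V : GaugeField (F.P n) 0 (Matrix.specialUnitaryGroup (Fin 2) ℂ)),
                PlaqSmall (θBal F.L γ (hF ▸ 𝔠).b₀ (hF ▸ 𝔠).p₀ n) V →
                  |(p (K + 1)).T.Pint (K + 1 - n) (Hist.triv (F.P (K + 1)) (K + 1 - n))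
                      (fieldShift (F.sitesPerDir_eq (m := F.m) (K := K + 1) (j := K + 1 - n) (m' := F.m) (K' := n) (j' := 0) (by omega)) V) -
                    (p K).T.Pint (K - n) (Hist.triv (F.P K) (K - n))
                      (fieldShift (F.sitesPerDir_eq (m := F.m) (K := K) (j := K - n) (m' := F.m) (K' := n) (j' := 0) (by omega)) V) - c K n| ≤
                    C * θBal F.L γ (hF ▸ 𝔠).b₀ (hF ▸ 𝔠).p₀ n ^ 2 * (((F.P K).sitesPerDir (K - n) ^ 3 : ℕ) : ℝ) * (((F.L : ℝ) ^ (K - n))⁻¹) ^ a) :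

    ∀ (L : ℕ), Odd L → 7 ≤ L → ∀ (𝔠 : Summit.QuantumFields.Balaban3D.Proofs.Primitives.AlphaConsts L (Summit.QuantumFields.Balaban3D.Carriers.suGroupModel 2).N)
      (a₀ a₁ : ℝ), 0 < a₀ → 0 < a₁ → 𝔠.B₃ * a₁ ≤ a₀ →
      ∃ a : ℝ, 0 < a ∧ ∃ γB : ℝ, 0 < γB ∧ ∀ (F : T3Family) (γ : ℝ) (hF : F.L = L) (hγ : 0 < γ), γ ≤ γB →
        ∀ (hγ1 : γ ≤ (min (hF ▸ 𝔠).gamma0 1) ^ 2),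
          Summit.QuantumFields.YangMills.Theorems.AlphaInputsT3AC.OfV3At F (hF ▸ 𝔠) a₀ a₁ →
          ∃ (p : ∀ K, Summit.QuantumFields.YangMills.Theorems.AlphaInputsT3AC.PkgAtV3 F (hF ▸ 𝔠) γ hγ hγ1 K),
            (∀ K, (p K).a₀ = a₀ ∧ (p K).a₁ = a₁) ∧
            ∃ (π : Summit.QuantumFields.YangMills.Theorems.AlphaInputsT3AC.PolymerT3 F) (PT : TermFn F),
              PintDecompTrivT (Summit.QuantumFields.YangMills.Theorems.AlphaInputsT3AC.dataOfV3 p π) PT ∧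
                TwoRunMinT (Summit.QuantumFields.YangMills.Theorems.AlphaInputsT3AC.dataOfV3 p π) PT (hF ▸ 𝔠).b₀ (hF ▸ 𝔠).p₀ a := by
  intro L hLo h7 𝔠 a₀ a₁ ha0 ha1 hw
  obtain ⟨a, ha, C, γB, hγB, hfam⟩ := hGlob L hLo h7 𝔠 a₀ a₁ ha0 ha1 hw
  refine ⟨a, ha, γB, hγB, fun F γ hF hγ hγB' hγ1 hOf => ?_⟩
  obtain ⟨p, hp, hG⟩ := hfam F γ hF hγ hγB' hγ1 hOf
  exact ⟨p, hp, twoRunMinT_blocks_of_global p hG⟩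

end Registered

end Summit.QuantumFields.YangMills.Theorems.LogComparisonTwoRunBlocks

end
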